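/-
Fleet lead `ym-wcr-19609-p1` (seat prover-ym-wcr-19609-p1-g2-0), route `WeakCouplingRates`, crux `BulkDominatesColdBoxW`
(stmt-QuantumFields-19609), line `dlr-chessboard` (v4), brick M3c of the census v3 (item evidence #12).
-/
import Summits.QuantumFields.YangMills.Theorems.WeakCouplingRatesBulkDominatesColdBoxWDatumBackground
import Summits.QuantumFields.YangMills.Theorems.WeakCouplingRatesColdBoxDirichletDensity

/-!
# Crux `BulkDominatesColdBoxW`, stubs L1a/L1b: a boundary datum SHIFTS THE MEAN of the Dirichlet Gaussian — the integral identity,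
# and the homogeneity of the Maxwell form under the rescaling `t = √(2β)·v`

Brick M3c of the census v3 of the line `dlr-chessboard` (item evidence #12).  With a datum `θ` on the pinned edges, the one-colour Gaussian
weight of the one-scale expansion is `e^{−½ M_θ(s)}` (`LatticeMaxwell.wθ`); completing the square (`formM_eq_sq_of_posDef`, file
`…DatumBackground`, PosDef from `posDef_dirQmat`) and the translation invariance of Lebesgue measure give, for every measurable `g ≥ 0`,

  `∫ g(s) e^{−½ M_θ(s)} ds = e^{−K_θ/2} · Z_D · E_{boxDirichlet H}[ g(μ_θ + ·) ]`      (`lintegral_mul_wθ_dir_eq`),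

so that normalised expectations under the datum-`θ` Gaussian are expectations under the SAME cold-wall Dirichlet Gaussian D1' of the
observable translated by the mean `μ_θ = LatticeMaxwell.mean … θ` (`lintegral_mul_wθ_dir_div_eq`).  Also recorded: the Maxwell form, the
mean and the constant are homogeneous under a common rescaling of datum and free variables (`glue_smul`, `formM_smul`, `vvec_smul`,
`mean_smul`), which is how the assembly passes from `e^{−β Σ_p s_p(v)²}` to `e^{−½ M_{θ'}(t)}` with `t = √(2β)v`, `θ' = √(2β)θ`.
No new definition; standard axioms.  NOT a claim about the mass gap.
-/

set_option autoImplicit false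

noncomputable section

open MeasureTheory Finset Matrix WithLp
open scoped ENNReal
open Literature.Probability.LatticeModels
open Literature.MathematicalPhysics.QuantumLattice
open Literature.MathematicalPhysics.QuantumFieldTheory
open Literature.MathematicalPhysics.QuantumFieldTheory.LatticeMaxwell
open Literature.MathematicalPhysics.QuantumFieldTheory.AxialGauge
open Literature.MathematicalPhysics.QuantumFieldTheory.GaussianToolkit

namespace Summit.QuantumFields.YangMills.Theorems.WeakCouplingRates

/-! ## §1 Homogeneity of the Maxwell form with datum (general pinned box) -/

section Homogeneity

variable {d : ℕ} {pin : Literature.MathematicalPhysics.QuantumLattice.ZdEdge d → Prop} [DecidablePred pin]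
  {a : Site d} {n : ℕ}

/-- `glue (c•θ) (c•s) = c • glue θ s`. -/
theorem glue_smul (c : ℝ) (θ : Literature.MathematicalPhysics.QuantumLattice.ZdEdge d → ℝ) (s : LatticeMaxwell.Free pin a n → ℝ)
    (e : Literature.MathematicalPhysics.QuantumLattice.ZdEdge d) :
    LatticeMaxwell.glue (pin := pin) a n (c • θ) (c • s) e = c * LatticeMaxwell.glue (pin := pin) a n θ s e := by
  unfold LatticeMaxwell.glue
  split_ifs <;> simp

/-- **Homogeneity of degree two**: `M_{cθ}(cs) = c² M_θ(s)`. -/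
theorem formM_smul (c : ℝ) (θ : Literature.MathematicalPhysics.QuantumLattice.ZdEdge d → ℝ) (s : LatticeMaxwell.Free pin a n → ℝ) :
    formM pin a n (c • θ) (c • s) = c ^ 2 * formM pin a n θ s := by
  unfold formM
  rw [Finset.mul_sum]
  refine Finset.sum_congr rfl fun p _ => ?_
  have : sCirc (LatticeMaxwell.glue (pin := pin) a n (c • θ) (c • s)) (Plaq.shift a p) =
      c * sCirc (LatticeMaxwell.glue (pin := pin) a n θ s) (Plaq.shift a p) := by
    simp only [sCirc, glue_smul]; ring
  rw [this]; ring

/-- `glue (c•θ) 0 = c • glue θ 0`. -/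
theorem glue_smul_zero (c : ℝ) (θ : Literature.MathematicalPhysics.QuantumLattice.ZdEdge d → ℝ)
    (e : Literature.MathematicalPhysics.QuantumLattice.ZdEdge d) :
    LatticeMaxwell.glue (pin := pin) a n (c • θ) (0 : LatticeMaxwell.Free pin a n → ℝ) e =
      c * LatticeMaxwell.glue (pin := pin) a n θ (0 : LatticeMaxwell.Free pin a n → ℝ) e := by
  have h := glue_smul (pin := pin) (a := a) (n := n) c θ 0 e
  rwa [smul_zero] at h

/-- `b_p(cθ) = c · b_p(θ)`. -/
theorem bterm_smul (c : ℝ) (θ : Literature.MathematicalPhysics.QuantumLattice.ZdEdge d → ℝ) (p : Plaq d) :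
    bterm pin a n (c • θ) p = c * bterm pin a n θ p := by
  simp only [bterm, sCirc, glue_smul_zero]; ring

/-- `v_{cθ} = c • v_θ`. -/
theorem vvec_smul (c : ℝ) (θ : Literature.MathematicalPhysics.QuantumLattice.ZdEdge d → ℝ) :
    vvec pin a n (c • θ) = c • vvec pin a n θ := by
  unfold vvec
  rw [Finset.smul_sum]
  refine Finset.sum_congr rfl fun p _ => ?_
  rw [bterm_smul, smul_smul]

/-- **The mean is linear in the datum**: `μ_{cθ} = c • μ_θ`. -/
theorem mean_smul (c : ℝ) (θ : Literature.MathematicalPhysics.QuantumLattice.ZdEdge d → ℝ) :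
    mean pin a n (c • θ) = c • mean pin a n θ := by
  unfold mean
  rw [vvec_smul, Matrix.mulVec_smul, smul_neg]

end Homogeneity

/-! ## §2 The weight with datum is a translate of the centred weight (general pinned box, PosDef) -/

section Weight

variable {d : ℕ} {pin : Literature.MathematicalPhysics.QuantumLattice.ZdEdge d → Prop} [DecidablePred pin]
  {a : Site d} {n : ℕ}

/-- `e^{−½M_θ(s)} = e^{−K_θ/2} · e^{−½ (s−μ_θ)ᵀQ(s−μ_θ)}` (the tree's `LatticeMaxwell.wθ_eq` with the comb hypothesis replaced by `Q.PosDef`). -/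
theorem wθ_eq_of_posDef (hQ : (Qmat pin a n).PosDef) (θ : Literature.MathematicalPhysics.QuantumLattice.ZdEdge d → ℝ)
    (s : EuclideanSpace ℝ (LatticeMaxwell.Free pin a n)) :
    wθ pin a n θ s = ENNReal.ofReal (Real.exp (-(Kconst pin a n θ) / 2)) *
      gaussWeight (Qmat pin a n) (s - WithLp.toLp 2 (mean pin a n θ)) := by
  rw [wθ, gaussWeight, formM_eq_sq_of_posDef hQ, ← ENNReal.ofReal_mul (Real.exp_pos _).le, ← Real.exp_add]
  congr 2
  simp only [WithLp.ofLp_sub]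
  ring

end Weight

/-! ## §3 The Dirichlet box: Gaussian integrals with datum are translated D1' expectations -/

section Dirichlet

/-- **The mean-shift identity**: for measurable `g ≥ 0` and every datum `θ`,
`∫ g(s) e^{−½M_θ(s)} ds = e^{−K_θ/2} · Z_D · ∫ g(t + μ_θ) d(boxDirichlet H)(t)`. -/
theorem lintegral_mul_wθ_dir_eq (H : ℕ) (θ : Literature.MathematicalPhysics.QuantumLattice.ZdEdge 4 → ℝ)
    (g : EuclideanSpace ℝ (DirFree H) → ℝ≥0∞) (hg : Measurable g) :
    ∫⁻ s, g s * wθ (fun e => e ∉ dirFreeEdges H) dirCorner (2 * H + 3) θ s ∂(volume : Measure (EuclideanSpace ℝ (DirFree H))) =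
      ENNReal.ofReal (Real.exp (-(Kconst (fun e => e ∉ dirFreeEdges H) dirCorner (2 * H + 3) θ) / 2)) *
        gaussZ (Qmat (fun e => e ∉ dirFreeEdges H) dirCorner (2 * H + 3)) *
          ∫⁻ t, g (t + WithLp.toLp 2 (mean (fun e => e ∉ dirFreeEdges H) dirCorner (2 * H + 3) θ)) ∂(boxDirichlet H) := by
  set m : EuclideanSpace ℝ (DirFree H) := WithLp.toLp 2 (mean (fun e => e ∉ dirFreeEdges H) dirCorner (2 * H + 3) θ) with hm
  set K := ENNReal.ofReal (Real.exp (-(Kconst (fun e => e ∉ dirFreeEdges H) dirCorner (2 * H + 3) θ) / 2)) with hK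
  have hw : ∀ s, wθ (fun e => e ∉ dirFreeEdges H) dirCorner (2 * H + 3) θ s =
      K * gaussWeight (Qmat (fun e => e ∉ dirFreeEdges H) dirCorner (2 * H + 3)) (s - m) :=
    fun s => wθ_eq_of_posDef (posDef_dirQmat H) θ s
  simp_rw [hw]
  have hmeas : Measurable fun s : EuclideanSpace ℝ (DirFree H) =>
      g s * gaussWeight (Qmat (fun e => e ∉ dirFreeEdges H) dirCorner (2 * H + 3)) (s - m) :=
    hg.mul ((measurable_gaussWeight _).comp (measurable_sub_const m))
  have hshift : ∫⁻ s, g s * gaussWeight (Qmat (fun e => e ∉ dirFreeEdges H) dirCorner (2 * H + 3)) (s - m)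
        ∂(volume : Measure (EuclideanSpace ℝ (DirFree H))) =
      ∫⁻ t, g (t + m) * gaussWeight (Qmat (fun e => e ∉ dirFreeEdges H) dirCorner (2 * H + 3)) t
        ∂(volume : Measure (EuclideanSpace ℝ (DirFree H))) := by
    rw [← lintegral_add_right_eq_self (μ := (volume : Measure (EuclideanSpace ℝ (DirFree H))))
      (fun s => g s * gaussWeight (Qmat (fun e => e ∉ dirFreeEdges H) dirCorner (2 * H + 3)) (s - m)) m]
    exact lintegral_congr fun t => by rw [add_sub_cancel_right]
  have hZ := lintegral_mul_gaussWeight_eq H (fun t => g (t + m)) (hg.comp (measurable_add_const m))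
  calc ∫⁻ s, g s * (K * gaussWeight (Qmat (fun e => e ∉ dirFreeEdges H) dirCorner (2 * H + 3)) (s - m))
        ∂(volume : Measure (EuclideanSpace ℝ (DirFree H)))
      = K * ∫⁻ s, g s * gaussWeight (Qmat (fun e => e ∉ dirFreeEdges H) dirCorner (2 * H + 3)) (s - m)
          ∂(volume : Measure (EuclideanSpace ℝ (DirFree H))) := by
        rw [← lintegral_const_mul _ hmeas]
        exact lintegral_congr fun s => by ring
    _ = K * (gaussZ (Qmat (fun e => e ∉ dirFreeEdges H) dirCorner (2 * H + 3)) * ∫⁻ t, g (t + m) ∂(boxDirichlet H)) := by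
        rw [hshift]
        exact congrArg (fun z => K * z) hZ
    _ = K * gaussZ (Qmat (fun e => e ∉ dirFreeEdges H) dirCorner (2 * H + 3)) * ∫⁻ t, g (t + m) ∂(boxDirichlet H) := by
        rw [mul_assoc]

/-- The total mass of the weight with datum: `∫ e^{−½M_θ} = e^{−K_θ/2} · Z_D` (finite and nonzero). -/
theorem lintegral_wθ_dir_eq (H : ℕ) (θ : Literature.MathematicalPhysics.QuantumLattice.ZdEdge 4 → ℝ) :
    ∫⁻ s, wθ (fun e => e ∉ dirFreeEdges H) dirCorner (2 * H + 3) θ s ∂(volume : Measure (EuclideanSpace ℝ (DirFree H))) =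
      ENNReal.ofReal (Real.exp (-(Kconst (fun e => e ∉ dirFreeEdges H) dirCorner (2 * H + 3) θ) / 2)) *
        gaussZ (Qmat (fun e => e ∉ dirFreeEdges H) dirCorner (2 * H + 3)) := by
  have h := lintegral_mul_wθ_dir_eq H θ (fun _ => 1) measurable_const
  simp only [one_mul, lintegral_const, measure_univ, mul_one] at h
  exact h

/-- **Normalised form**: the expectation of `g` under the datum-`θ` Gaussian `e^{−½M_θ}ds / ∫e^{−½M_θ}` is the D1' expectation of the
translated observable, `E_D[g(· + μ_θ)]`. -/
theorem lintegral_mul_wθ_dir_div_eq (H : ℕ) (θ : Literature.MathematicalPhysics.QuantumLattice.ZdEdge 4 → ℝ)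
    (g : EuclideanSpace ℝ (DirFree H) → ℝ≥0∞) (hg : Measurable g) :
    (∫⁻ s, g s * wθ (fun e => e ∉ dirFreeEdges H) dirCorner (2 * H + 3) θ s ∂(volume : Measure (EuclideanSpace ℝ (DirFree H)))) /
        ∫⁻ s, wθ (fun e => e ∉ dirFreeEdges H) dirCorner (2 * H + 3) θ s ∂(volume : Measure (EuclideanSpace ℝ (DirFree H))) =
      ∫⁻ t, g (t + WithLp.toLp 2 (mean (fun e => e ∉ dirFreeEdges H) dirCorner (2 * H + 3) θ)) ∂(boxDirichlet H) := by
  obtain ⟨-, hZ0, hZtop⟩ := boxDirichlet_eq_withDensity H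
  rw [lintegral_mul_wθ_dir_eq H θ g hg, lintegral_wθ_dir_eq H θ]
  set K := ENNReal.ofReal (Real.exp (-(Kconst (fun e => e ∉ dirFreeEdges H) dirCorner (2 * H + 3) θ) / 2)) with hK
  set Z := gaussZ (Qmat (fun e => e ∉ dirFreeEdges H) dirCorner (2 * H + 3)) with hZ
  have hK0 : K ≠ 0 := by rw [hK]; exact ENNReal.ofReal_ne_zero_iff.2 (Real.exp_pos _)
  have hKtop : K ≠ ∞ := ENNReal.ofReal_ne_top
  have hKZ0 : K * Z ≠ 0 := mul_ne_zero hK0 hZ0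
  have hKZtop : K * Z ≠ ∞ := ENNReal.mul_ne_top hKtop hZtop
  rw [mul_comm (K * Z), ENNReal.mul_div_cancel_right hKZ0 hKZtop]

end Dirichlet

end Summit.QuantumFields.YangMills.Theorems.WeakCouplingRates

end
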